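import Literature.MathematicalPhysics.QuantumFieldTheory.Balaban1983to89.B8Thm2TorusKnitMajorantsOfCubes
import Literature.MathematicalPhysics.QuantumFieldTheory.Balaban1983to89.B8Thm2SetupTorusOfMajorants

/-!
# `Balaban1983to89.B8Thm2SetupTorusOfCubes` — M5.9 ASSEMBLY, FILE A9 (endpoint): [Balaban1985RegularSpaces] Theorem 2 on the torus `T_η` for `SU(N)` and at the
# `SU(N)`-valued Setup-torus objects `Thm2SetupSUAt (PV d ℓ m K) N k η 0 B₁ B₂ c₁ len ⊤` — the currency of the R3 consumer on `stmt-QuantumFields-19200` — FROM THE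
# CUBE PACKAGES of sub-row G-B9-LETTERS (file A8's `KnitCubeInputs` at every member and background), the (B)-lines and a member catalogue; with `B₁, B₂, c₁`
# UNIFORM over the volume `m`, the number of steps `K`, the level `k` and `η` (the consumer `Prop7SPrintThm2Dict.prop2Printed_sPrint_of_thm2SetupSUAt` needs them
# uniform over the family), and the endpoint's derived numeric windows `B_G, B₀′ᴴ, B₂′, B_R, B₀′, B₁` DISCHARGED by explicit choice (§4)

statement-level skeleton of published theorems with citation tags; proofs where landed; nothing here is a claim about the
Yang–Mills mass gap

T. Bałaban, *Spaces of regular gauge field configurations on a lattice and gauge fixing conditions*, Commun. Math. Phys. **99** (1985) 75–102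
[`Balaban1985RegularSpaces`, "[B8]"]: Thm 2 p. 83, (1.33)–(1.39) pp. 82–83, (1.7) p. 77, p. 77 (*«we admit the case where some domains Ω_j are equal to T_η»*), p. 76
(*«G = SU(N)»*), (1.91)–(1.98) pp. 91–92, (1.101) p. 93, (1.59) p. 86.  T. Bałaban, *Propagators for lattice gauge theories in a background field*, Commun. Math. Phys.
**99** (1985) 389–434 [`Balaban1985BackgroundPropagators`, "[4]"]: Thm 3.1 (3.42) p. 397, Thm 3.2 (3.48) p. 398, Thm 3.7 (3.87)–(3.90) pp. 409–410, Thm 3.9 p. 413,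
(3.19)–(3.25) pp. 393–394.  T. Bałaban, *Averaging operations for lattice gauge theories*, Commun. Math. Phys. **98** (1985) 17–51 [`Balaban1985Averaging`]: (4) p. 18,
Prop. 2 p. 26, (52) p. 26.  STATUS: published, refereed.

THE PRINT.  [B8] Thm 2 p. 83: *«we can take β₀, α₁ arbitrary positive numbers and then there exists B₁ such that the above theorem holds»*; its Landau-gauge letters
are [4]'s `G′(U)`, `(Q′G′²Q′*)⁻¹(U)`, `H′(U)` whose bounds (1.101) ∕ (1.98) are [4] Thms 3.1–3.2, proved there (pp. 409–413) by the cube expansions of Thm 3.7 ∕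
Thm 3.9 from Cor. 3.6 at the cube letters, (3.89) and [Balaban1984PropagatorsII] Lemma 2.1.

WHY THIS FILE ∕ THE ARGUMENT.  File A6 (`B8Thm2SetupTorusOfMajorants.thm2SetupSUAt_ofMajorants_tr`, seat g4) reached the consumer's currency from the displayed
block majorants `KnitMajorants`; file A8 (`knitMajorants_of_cubes`) reads those off the cube packages `KnitCubeInputs`.  Composing them needs one more
dictionary entry: junction file 15's flatness hypothesis `pdev (liftCfg U) < α₀′L^{−2k}` at the MEMBER's finest scale `L^{−k}` (k = the member's nominal index
`i.k`), while the consumer's class (1.7) `U₀ ∈ 𝔄_n(T_η, α₀)` gives `pdev U₀ ≤ α₀L^{−2n}` at the member's constant LEVEL `n` (`constLev_le : n ≤ i.k`).  §1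
bridges the two under a displayed LEVEL SLACK `i.k ≤ n + e_s` of the catalogue with the uniform choice `c_L·L^{2e_s} < α₀′` (so `α₀′` is member- and
background-free and the [Balaban1985Averaging] Prop. 2 thresholds on `α₀′` imply those on `c_L`).  §2 is file A5's torus endpoint with hypothesis (ii) re-keyed,
§3 the Setup-torus form with `∃ B₂ c₁` IN FRONT of `m, K`, §4 the same with the six derived windows chosen explicitly, leaving `∃ B₁ B₂ c₁ > 0` and, as displayed
antecedents, ONLY: the member catalogue, the cube packages (M5.1–M5.6's output shapes), the (B)-lines (M5.7–M5.8), and the scalar side conditions.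

CITATION HEADER (lean-in-tree rule).  Cell `lit-balaban`, seat `lit-balaban-t2s-1` (gen 5), MODULE M5.9, file A9; sub-row G-B8-T2S (R3 `stmt-QuantumFields-19200`,
helper; consumer `B8Thm2SetupTorus.thm2SetupSUAt_of_thm2TorusAt → BirthV8∕V9.stub_PV3A` via `Prop7SPrintThm2Dict.prop2Printed_sPrint_of_thm2SetupSUAt`).  REUSED BY
NAME: file A5 `thm2TorusAt_specialUnitary_ofMajorants_tr` (g4), file A8 `knitMajorants_of_cubes`, `KnitCubeParams.knitConstants_of_valid` (g5), file A3
`parKnitY_mem_of_inAk`, `pdev_le_of_inAk_univ`, `threshold3_of_le`, `threshold2_of_le` (g4), file A2 `bgY_mem`, `liftCfg_bgY`, `shiftCfg_U₀` (g4),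
`B8Thm2SetupTorus.thm2SetupSUAt_of_thm2TorusAt`, `pow_dvd_period`, `B7AvgClosedSpecialUnitarySharp.avgClosed_specialUnitary_of_le`.

WHAT THIS FILE PROVES (sorry-free; no definitions; nothing of [B8]∕[4]'s estimates asserted).
* §1 `le_mul_pow_of_one_le`, ★ `pdev_liftCfg_bgY_lt_of_inAk` — `U₀ ∈ 𝔄_n(T_η, α₀)`, `α₀ ≤ c_L`, `c_L·L^{2e_s} < α₀′`, `i.k ≤ n + e_s`, `U₀` periodic for the member's torus
  ⟹ `pdev (liftCfg (bgY i U₀)) < α₀′L^{−2·i.k}`; `thresholds_of_slack` (`C₀c_L ≤ 1∕3`, `2c_L ≤ c₂′` from those on `α₀′`).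
* §2 ★★★★★★ **`thm2TorusAt_specialUnitary_ofCubes_tr`** — file A5's endpoint with (ii) := `Nonempty (KnitCubeInputs (memF k P n) (bgY … U₀) b (ιBF k P n) Rr Hp p c
  (sF k P n))` for every member and every `SU(N)`-valued `P`-periodic `U₀ ∈ 𝔄_n(T_η, α₀)`, `α₀ ≤ c_L`, and the catalogue's level slack displayed.
* §3 ★★★★★★ **`thm2SetupSUAt_ofCubes_tr`** — the Setup-torus form: ONE pair `B₂, c₁ > 0` serving every `m, K`, every `1 ≤ k ≤ m + K`, every `η > 0`.
* §4 `windowBG`, `windowBH`, `windowB₂`, `windowBR`, `windowB₀'`, `windowB₁` (explicit), ★★★★★★★ **`thm2SetupSUAt_ofCubes_exists`** — `∃ B₁ B₂ c₁ > 0` such that for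
  every `m K k η` (`1 ≤ k ≤ m + K`, `η > 0`): catalogue → cube packages → (B)-lines → `Thm2SetupSUAt (PV d ℓ m K hd hL) N k η 0 B₁ B₂ c₁ len (fun _ => True)`; the
  only numeric inputs left are the (B)-line constants `B₀ ≥ 2∕(5(d+1)L)`, `c_B9 > 0`, the threshold `c_L > 0` with its slack coupling, and `p.Valid`.

HONEST SCOPE.  Glue only: the catalogue (def-Y carrier owners; NB `KIdx.hk2 : 2 ≤ k` — a constant-level-1 member needs nominal index `2`, whence the slack `e_s ≥ 1`
for it), the cube packages (M5.1b∕c, M5.2, M5.4, M5.5, M5.6 — in particular `hD` = GAP G-B9-05 is NOT derived in the tree) and the (B)-lines (M5.7–M5.8) are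
displayed antecedents inhabited by nothing here; count-neutral; N05 ∕ `stub_PV3A` NOT discharged; nothing continuum ∕ ℝ⁴ ∕ OS ∕ mass-gap ∕ Clay — the
Yang–Mills mass gap is NOT proved.  No `sorry`, no `axiom`, no `… : Prop` fact, no `instance`, no `notation`.  NEW file; nothing landed is modified.  Seat
`lit-balaban-t2s-1` gen 5, 2026-08-28.
-/

noncomputable section

open scoped BigOperators

namespace Literature.MathematicalPhysics.QuantumFieldTheory.Balaban1983to89.B8Thm2SetupTorusOfCubes

open Node00 B6KLevelCensusIndexV1 B9Eq39Adjoint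
open B7Prop1Explicit renaming Site → LSite
open B7Prop1Explicit (e)
open B7Prop2Explicit (unitaryUnits AvgClosed pdev C0 c2' C0_pos)
open B9Thm34Ext (toB6)
open B9GeoNormsKLevelV1 (geo9K)
open B8Ineq132 (InAk)
open B12Ineq417Flat (shiftCfg)
open B6GlobalChartV1 (PV)
open B8Thm2TorusAt (Thm2TorusAt)
open B9B8CarrierDictionary (liftCfg)
open B9B8AveragingJunction (parKnitY)
open B9B8KnitLetterPeriodic (constLev_le)
open B8Thm2TorusLettersPerOfKnit (bgY bgY_mem liftCfg_bgY shiftCfg_U₀)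
open B8Thm2TorusLettersAllPerOfKnit (parKnitY_mem_of_inAk pdev_le_of_inAk_univ threshold3_of_le threshold2_of_le)
open B8Thm2TorusKnitEstimatesOfMajorants (KnitMajorants B9P3PerAt)
open B8Thm2TorusLettersTauOfKnit (thm2TorusAt_specialUnitary_ofMajorants_tr)
open B8Thm2TorusKnitMajorantsOfCubes (KnitCubeParams KnitCubeInputs knitMajorants_of_cubes)
open B7Prop2SpecialUnitary (specialUnitaryUnits specialUnitaryUnits_le_unitaryUnits)
open B7AvgClosedSpecialUnitarySharp (avgClosed_specialUnitary_of_le)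
open B8Thm2SetupTorus (Thm2SetupSUAt thm2SetupSUAt_of_thm2TorusAt pow_dvd_period)
open scoped Matrix Matrix.Norms.L2Operator

variable {d ℓ : ℕ} {hd : 1 ≤ d + 1} {hL : Odd (ℓ + 1) ∧ 1 < ℓ + 1} {b₀ b₁ : ℝ}

/-! ## §1 The flatness of the background at the member's finest scale from the consumer's class (1.7), under the catalogue's level slack -/

section Flatness

/-- arithmetic: `1 ≤ x`, `0 ≤ a` ⟹ `a ≤ a·xⁿ`. [cite: Balaban1985RegularSpaces, (1.7) p.77, bookkeeping] -/
theorem le_mul_pow_of_one_le {a x : ℝ} (ha : 0 ≤ a) (hx : 1 ≤ x) (n : ℕ) : a ≤ a * x ^ n :=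
  le_mul_of_one_le_right ha (one_le_pow₀ hx)

/-- **the [Balaban1985Averaging] Prop. 2 thresholds on `c_L` from those on `α₀′`** when `c_L·L^{2e_s} < α₀′` (`c_L ≥ 0`, `L ≥ 1`).
[cite: Balaban1985Averaging, Prop. 2 p.26, (52)–(54) pp.26–27, bookkeeping] -/
theorem thresholds_of_slack {cL α₀' : ℝ} (hcL : 0 ≤ cL) {es : ℕ} (hαe : cL * (((ℓ + 1 : ℕ) : ℝ)) ^ (2 * es) < α₀')
    (hα3 : C0 (d + 1) * α₀' ≤ 1 / 3) (hα2 : 2 * α₀' ≤ c2' (d + 1) (ℓ + 1)) :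
    C0 (d + 1) * cL ≤ 1 / 3 ∧ 2 * cL ≤ c2' (d + 1) (ℓ + 1) := by
  have hL1 : (1 : ℝ) ≤ (((ℓ + 1 : ℕ) : ℝ)) := by exact_mod_cast Nat.succ_le_succ (Nat.zero_le ℓ)
  have hle : cL ≤ α₀' := ((le_mul_pow_of_one_le hcL hL1 (2 * es)).trans hαe.le)
  exact ⟨(mul_le_mul_of_nonneg_left hle (C0_pos (d + 1)).le).trans hα3, (mul_le_mul_of_nonneg_left hle zero_le_two).trans hα2⟩

variable {𝔸 : Type} [NormedRing 𝔸] [NormedAlgebra ℂ 𝔸] [CompleteSpace 𝔸]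

/-- ★ **THE CONSUMER's CLASS (1.7) AT LEVEL `n` ⟹ JUNCTION FILE 15's FLATNESS AT THE MEMBER's FINEST SCALE**, under the catalogue's level slack: for a member `i`
with `i.k ≤ n + e_s`, a `U₀ ∈ 𝔄_n(T_η, α₀)` periodic for the member's torus, `0 ≤ α₀ ≤ c_L` and `c_L·L^{2e_s} < α₀′`:
`pdev (liftCfg (bgY i U₀)) = pdev U₀ ≤ α₀L^{−2n} ≤ c_L L^{2e}·L^{−2(n+e)} < α₀′L^{−2·i.k}`.
[cite: Balaban1985RegularSpaces, (1.7) p.77, p.77 («Ω_j = T_η»); Balaban1985Averaging, (52) p.26; Balaban1984PropagatorsII, (2.3)–(2.4) p.224] -/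
theorem pdev_liftCfg_bgY_lt_of_inAk (i : KIdx d ℓ hd hL b₀ b₁) {n es : ℕ} (hke : i.k ≤ n + es)
    {U₀ : LSite (d + 1) → Fin (d + 1) → 𝔸ˣ}
    (hU₀per : ∀ μ : Fin (d + 1), shiftCfg ((((PV d ℓ i.m i.K hd hL).sitesPerDir 0 : ℕ) : ℤ) • e μ) U₀ = U₀)
    {η α₀ cL α₀' : ℝ} (hα : 0 ≤ α₀) (hαc : α₀ ≤ cL) (hαe : cL * (((ℓ + 1 : ℕ) : ℝ)) ^ (2 * es) < α₀')
    (hA : InAk (ℓ + 1) n η α₀ (fun _ => (Set.univ : Set (LSite (d + 1)))) U₀) :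
    pdev (liftCfg (bgY i U₀)) < α₀' * ((((ℓ + 1 : ℕ) : ℝ) ^ i.k)⁻¹) ^ 2 := by
  rw [liftCfg_bgY i hU₀per]
  set Lr : ℝ := (((ℓ + 1 : ℕ) : ℝ)) with hLr
  have hL1 : (1 : ℝ) ≤ Lr := by rw [hLr]; exact_mod_cast Nat.succ_le_succ (Nat.zero_le ℓ)
  have hLpos : 0 < Lr := lt_of_lt_of_le one_pos hL1
  have hcL : 0 ≤ cL := hα.trans hαc
  have h1 : pdev U₀ ≤ α₀ * ((Lr ^ n)⁻¹) ^ 2 := pdev_le_of_inAk_univ hα hA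
  -- `α₀ L^{−2n} ≤ c_L L^{−2n}` and `c_L L^{2k} ≤ c_L L^{2(n+e)}`
  have h2 : α₀ * ((Lr ^ n)⁻¹) ^ 2 ≤ cL * ((Lr ^ n)⁻¹) ^ 2 := mul_le_mul_of_nonneg_right hαc (sq_nonneg _)
  have hk2 : Lr ^ (2 * i.k) ≤ Lr ^ (2 * n) * Lr ^ (2 * es) := by
    rw [← pow_add]; exact pow_le_pow_right₀ hL1 (by omega)
  -- the comparison, cleared of denominators
  have hn0 : 0 < Lr ^ (2 * n) := pow_pos hLpos _
  have hk0 : 0 < Lr ^ (2 * i.k) := pow_pos hLpos _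
  have key : cL * ((Lr ^ n)⁻¹) ^ 2 < α₀' * ((Lr ^ i.k)⁻¹) ^ 2 := by
    have e1 : ((Lr ^ n)⁻¹) ^ 2 = (Lr ^ (2 * n))⁻¹ := by rw [inv_pow, ← pow_mul, mul_comm]
    have e2 : ((Lr ^ i.k)⁻¹) ^ 2 = (Lr ^ (2 * i.k))⁻¹ := by rw [inv_pow, ← pow_mul, mul_comm]
    rw [e1, e2, ← div_eq_mul_inv, ← div_eq_mul_inv, div_lt_div_iff₀ hn0 hk0]
    calc cL * Lr ^ (2 * i.k) ≤ cL * (Lr ^ (2 * n) * Lr ^ (2 * es)) := mul_le_mul_of_nonneg_left hk2 hcL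
      _ = cL * Lr ^ (2 * es) * Lr ^ (2 * n) := by ring
      _ < α₀' * Lr ^ (2 * n) := mul_lt_mul_of_pos_right hαe hn0
  exact h1.trans_lt (h2.trans_lt key)

end Flatness

/-! ## §2 ★★★★★★ [B8] Thm 2 on `T_η` for `SU(N)` from the cube packages, the (B)-lines and the catalogue -/

section Torus

variable {N : ℕ} [NeZero N]

/-- ★★★★★★ **[B8] THM 2 ON `T_η` FOR `SU(N)` (`N ≤ 25`), ITS LANDAU-GAUGE LETTERS BEING [4]'s OPERATORS AT PRINT's TRANSPORTERS, FROM THE CUBE PACKAGES** (file A5's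
`thm2TorusAt_specialUnitary_ofMajorants_tr` ∘ file A8's `knitMajorants_of_cubes`): uniform `B₂, c₁ > 0` such that for every `k ≥ 1`, `η > 0`, `P ∈ LᵏZ` — GIVEN
(i) the catalogue `memF k P n` of constant-level-`n` members on the torus of side `P` with nominal index `≤ n + e_s`, (ii) for every member and every `SU(N)`-valued
`P`-periodic `U₀ ∈ 𝔄_n(T_η, α₀)`, `α₀ ≤ c_L`, the CUBE PACKAGES `KnitCubeInputs` of file A8 (M5.5's Thm-3.7 data at `parSymY`, M5.6's Thm-3.9 data at `parKnitY`,
geometry) for the valid scalars `p` (`c_L·L^{2e_s} < α₀′`), (iii) the (B)-lines `B9P3PerAt` — `Thm2TorusAt (ℓ+1) k P η 0 B₁ B₂ c₁ len SU(N) ⊤` holds, under the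
endpoint's numeric windows and the four thresholds at `A := p.A`, `A₁ := p.AD`, `K := p.KC`.  HONEST SCOPE: (i)–(iii) displayed, inhabited by nothing here;
count-neutral; `stub_PV3A` NOT discharged; the Yang–Mills mass gap is NOT proved.
[cite: Balaban1985RegularSpaces, Thm 2 p.83, Thm 4 p.88, (1.7) p.77, p.76, p.77 («Ω_j = T_η»), (1.91)–(1.98) pp.91–92, (1.101) p.93, (1.59) p.86; Balaban1985BackgroundPropagators, Thm 3.1 (3.42) p.397, Thm 3.2 (3.48) p.398, Thm 3.7 (3.87)–(3.90) pp.409–410, Thm 3.9 p.413, (3.19)–(3.25) pp.393–394; Balaban1985Averaging, Prop. 2 p.26, (52) p.26; Balaban1984PropagatorsII, (2.61) p.234] -/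
theorem thm2TorusAt_specialUnitary_ofCubes_tr (hN : N ≤ 25) (hd2 : 2 ≤ d + 1)
    {B₀ B₀' B₀'H B₂' BG BR B₀β cB9 β cL B₁ : ℝ} {len : LSite (d + 1) → ℝ}
    (hB₀ : 0 < B₀) (hB₀' : 0 < B₀') (hB : 2 ≤ 5 * ((d + 1 : ℕ) : ℝ) * ((ℓ + 1 : ℕ) : ℝ) * B₀) (hB₀'H : 0 < B₀'H) (hB₂' : 0 ≤ B₂') (hBG : 0 ≤ BG)
    (hBR : 0 ≤ BR) (hcB9 : 0 < cB9) (hcL : 0 < cL) (hfree : 3 * (2 * ((d + 1 : ℕ) : ℝ) * (((ℓ + 1 : ℕ) : ℝ)) ^ 2) * BG * (BR + 2) ≤ B₀')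
    (hB₁ : 5 * ((d + 1 : ℕ) : ℝ) * ((ℓ + 1 : ℕ) : ℝ) * B₀ * (1 + 11 * (((d + 1 : ℕ) : ℝ)) ^ 2) < B₁)
    {ι : Type} [Fintype ι] [DecidableEq ι] {b : Module.Basis ι ℝ (Matrix (Fin N) (Fin N) ℂ)} {M₂ c : ℝ}
    (p : KnitCubeParams) (hp : p.Valid d ℓ b M₂) (es : ℕ) (hαe : cL * (((ℓ + 1 : ℕ) : ℝ)) ^ (2 * es) < p.α₀')
    (hBGe : (∑ j, ‖b j‖) * p.A * c * M₂ ≤ BG) (hBG₁ : (∑ j, ‖b j‖) * p.AD d b M₂ * c * M₂ ≤ BG)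
    (hBH : (∑ j, ‖b j‖) * (((M₂ * ∑ j, ‖b j‖) * p.A * p.A * p.KC b M₂ * B6.c1 p.d₁ p.ε₀ p.βx ^ 2) * c * M₂) ≤ B₀'H)
    (hBH₁ : (∑ j, ‖b j‖) * (((M₂ * ∑ j, ‖b j‖) * p.AD d b M₂ * p.A * p.KC b M₂ * B6.c1 p.d₁ p.ε₀ p.βx ^ 2) * c * M₂) ≤ B₀'H)
    (hB₂ : (∑ j, ‖b j‖) * (((M₂ * ∑ j, ‖b j‖) * p.A * p.KC b M₂ * B6.c1 p.d₁ p.ε₀ p.βx) * c * M₂)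
        + (∑ j, ‖b j‖) * (((M₂ * ∑ j, ‖b j‖) * p.A * p.A * p.KC b M₂ * B6.c1 p.d₁ p.ε₀ p.βx ^ 2) * c * M₂) ≤ B₂')
    (hBRe : 1 + (∑ j, ‖b j‖) * (((M₂ * ∑ j, ‖b j‖) ^ 2 * p.A * p.KC b M₂ * p.A * B6.c1 p.d₁ p.ε₀ p.βx ^ 2) * c * M₂) ≤ BR)
    (memF : ℕ → ℤ → ℕ → KIdx d ℓ hd hL b₀ b₁) [∀ k P n, Fintype (geo9K (memF k P n)).Site] [∀ k P n, DecidableEq (geo9K (memF k P n)).Site]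
    (ιBF : ∀ k P n, BlkY (memF k P n) → IBondY (memF k P n)) (Rr : ℝ) (Hp : Prop) (sF : ℕ → ℤ → ℕ → ℝ) :
    letI : CStarAlgebra (Matrix (Fin N) (Fin N) ℂ) := {}
    ∃ B₂ c₁ : ℝ, 0 < B₂ ∧ 0 < c₁ ∧ ∀ (k : ℕ) (P : ℤ) (η : ℝ), 1 ≤ k → 0 < η → (∃ M : ℤ, P = ((ℓ + 1 : ℕ) : ℤ) ^ k * M) →
      (∀ n, 1 ≤ n → n ≤ k → (((PV d ℓ (memF k P n).m (memF k P n).K hd hL).sitesPerDir 0 : ℕ) : ℤ) = P) →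
      (∀ n, 1 ≤ n → n ≤ k → ∀ z : SiteY (memF k P n), levY (memF k P n) z = n) →
      (∀ n, 1 ≤ n → n ≤ k → (memF k P n).k ≤ n + es) →
      (∀ n, 1 ≤ n → n ≤ k → ∀ ⦃α₀ : ℝ⦄, 0 < α₀ → α₀ ≤ cL → ∀ U₀ : LSite (d + 1) → Fin (d + 1) → (Matrix (Fin N) (Fin N) ℂ)ˣ,
          (∀ x κ, U₀ x κ ∈ specialUnitaryUnits (Fin N)) → (∀ (x : LSite (d + 1)) (μ : Fin (d + 1)), U₀ (x + P • e μ) = U₀ x) →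
          InAk (ℓ + 1) n η α₀ (fun _ => (Set.univ : Set (LSite (d + 1)))) U₀ →
          Nonempty (KnitCubeInputs (memF k P n) (bgY (memF k P n) U₀) b (ιBF k P n) Rr Hp p c (sF k P n))) →
      (∀ m, m ≤ k → ∀ ⦃α₀ : ℝ⦄, 0 < α₀ → α₀ ≤ cL → ∀ U₀ : LSite (d + 1) → Fin (d + 1) → (Matrix (Fin N) (Fin N) ℂ)ˣ,
          (∀ x κ, U₀ x κ ∈ specialUnitaryUnits (Fin N)) → (∀ (x : LSite (d + 1)) (μ : Fin (d + 1)), U₀ (x + P • e μ) = U₀ x) →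
          InAk (ℓ + 1) m η α₀ (fun _ => (Set.univ : Set (LSite (d + 1)))) U₀ →
          B9P3PerAt (𝔸 := Matrix (Fin N) (Fin N) ℂ) (ℓ + 1) B₀ B₀β cB9 β len η m α₀ P U₀) →
      Thm2TorusAt (ℓ + 1) k P η 0 B₁ B₂ c₁ len (specialUnitaryUnits (Fin N)) (fun _ => True) := by
  letI : CStarAlgebra (Matrix (Fin N) (Fin N) ℂ) := {}
  haveI : Nonempty (Fin N) := ⟨⟨0, Nat.pos_of_ne_zero (NeZero.ne N)⟩⟩
  obtain ⟨hc3, hc2⟩ := thresholds_of_slack (d := d) hcL.le hαe hp.hα3 hp.hα2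
  obtain ⟨B₂, c₁, hB₂pos, hc₁, H⟩ :=
    thm2TorusAt_specialUnitary_ofMajorants_tr (len := len) (B₀β := B₀β) (β := β) hN hd2 hB₀ hB₀' hB hB₀'H hB₂' hBG hBR hcB9 hcL hfree hB₁ hc3 hc2
      (KnitCubeParams.knitConstants_of_valid hp) hBGe hBG₁ hBH hBH₁ hB₂ hBRe memF ιBF Rr Hp sF
  refine ⟨B₂, c₁, hB₂pos, hc₁, fun k P η hk hη hPk hP hlev hke hcube hb9 => H k P η hk hη hPk hP hlev ?_ hb9⟩
  intro n hn hnk α₀ hα hαc U₀ hU₀G hU₀per hA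
  obtain ⟨inp⟩ := hcube n hn hnk hα hαc U₀ hU₀G hU₀per hA
  have hGa := avgClosed_specialUnitary_of_le hN (d + 1) (ℓ + 1)
  have hshift := shiftCfg_U₀ (memF k P) U₀ hP hU₀per hn hnk
  exact knitMajorants_of_cubes (memF k P n) b (ιBF k P n) specialUnitaryUnits_le_unitaryUnits hGa (bgY_mem (memF k P n) hU₀G)
    (parKnitY_mem_of_inAk (memF k P n) (hlev n hn hnk) hn hGa hU₀G hshift hα (threshold3_of_le hαc hc3) (threshold2_of_le hαc hc2) hA) hp
    (pdev_liftCfg_bgY_lt_of_inAk (memF k P n) (hke n hn hnk) hshift hα.le hαc hαe hA) inp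

end Torus

/-! ## §3 ★★★★★★ The Setup-torus form, `B₂, c₁` uniform over `m, K, k, η` -/

section Setup

variable {N : ℕ} [NeZero N]

/-- ★★★★★★ **[B8] THM 2 AT THE `SU(N)`-VALUED SETUP-TORUS OBJECTS OF EVERY `PV d ℓ m K`, FROM THE CUBE PACKAGES, (B)-LINES AND MEMBER CATALOGUE** (`1 ≤ N ≤ 25`,
`d + 1 ≥ 2`, `L = ℓ + 1`): ONE pair `B₂, c₁ > 0` such that for EVERY volume `m`, number of steps `K`, level `1 ≤ k ≤ m + K` and `η > 0`, with `P₀ = sitesPerDir 0`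
of `PV d ℓ m K` (`L^k ∣ P₀`, `pow_dvd_period`): catalogue props at `P₀` (constant level `n`, nominal index `≤ n + e_s`) → cube packages at every member and
background of the class → (B)-lines → `Thm2SetupSUAt (PV d ℓ m K hd hL) N k η 0 B₁ B₂ c₁ len (fun _ => True)` (§2 + `B8Thm2SetupTorus.thm2SetupSUAt_of_thm2TorusAt`;
`B₂, c₁` come from the windows alone, so they precede `m, K` — file A6 fixed `m, K` first).  HONEST SCOPE: antecedents displayed; the Yang–Mills mass gap is NOT
proved. [cite: Balaban1985RegularSpaces, Thm 2 p.83, (1.33)–(1.39) pp.82–83, p.77 («Ω_j = T_η»), p.76 («G = SU(N)»); Balaban1985BackgroundPropagators, Thm 3.1 (3.42) p.397, Thm 3.2 (3.48) p.398, Thm 3.7 pp.409–410, Thm 3.9 p.413; Balaban1985Averaging, (4) p.18, Prop. 2 p.26] -/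
theorem thm2SetupSUAt_ofCubes_tr (hN : N ≤ 25) (hd2 : 2 ≤ d + 1)
    {B₀ B₀' B₀'H B₂' BG BR B₀β cB9 β cL B₁ : ℝ} {len : LSite (d + 1) → ℝ}
    (hB₀ : 0 < B₀) (hB₀' : 0 < B₀') (hB : 2 ≤ 5 * ((d + 1 : ℕ) : ℝ) * ((ℓ + 1 : ℕ) : ℝ) * B₀) (hB₀'H : 0 < B₀'H) (hB₂' : 0 ≤ B₂') (hBG : 0 ≤ BG)
    (hBR : 0 ≤ BR) (hcB9 : 0 < cB9) (hcL : 0 < cL) (hfree : 3 * (2 * ((d + 1 : ℕ) : ℝ) * (((ℓ + 1 : ℕ) : ℝ)) ^ 2) * BG * (BR + 2) ≤ B₀')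
    (hB₁ : 5 * ((d + 1 : ℕ) : ℝ) * ((ℓ + 1 : ℕ) : ℝ) * B₀ * (1 + 11 * (((d + 1 : ℕ) : ℝ)) ^ 2) < B₁)
    {ι : Type} [Fintype ι] [DecidableEq ι] {b : Module.Basis ι ℝ (Matrix (Fin N) (Fin N) ℂ)} {M₂ c : ℝ}
    (p : KnitCubeParams) (hp : p.Valid d ℓ b M₂) (es : ℕ) (hαe : cL * (((ℓ + 1 : ℕ) : ℝ)) ^ (2 * es) < p.α₀')
    (hBGe : (∑ j, ‖b j‖) * p.A * c * M₂ ≤ BG) (hBG₁ : (∑ j, ‖b j‖) * p.AD d b M₂ * c * M₂ ≤ BG)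
    (hBH : (∑ j, ‖b j‖) * (((M₂ * ∑ j, ‖b j‖) * p.A * p.A * p.KC b M₂ * B6.c1 p.d₁ p.ε₀ p.βx ^ 2) * c * M₂) ≤ B₀'H)
    (hBH₁ : (∑ j, ‖b j‖) * (((M₂ * ∑ j, ‖b j‖) * p.AD d b M₂ * p.A * p.KC b M₂ * B6.c1 p.d₁ p.ε₀ p.βx ^ 2) * c * M₂) ≤ B₀'H)
    (hB₂ : (∑ j, ‖b j‖) * (((M₂ * ∑ j, ‖b j‖) * p.A * p.KC b M₂ * B6.c1 p.d₁ p.ε₀ p.βx) * c * M₂)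
        + (∑ j, ‖b j‖) * (((M₂ * ∑ j, ‖b j‖) * p.A * p.A * p.KC b M₂ * B6.c1 p.d₁ p.ε₀ p.βx ^ 2) * c * M₂) ≤ B₂')
    (hBRe : 1 + (∑ j, ‖b j‖) * (((M₂ * ∑ j, ‖b j‖) ^ 2 * p.A * p.KC b M₂ * p.A * B6.c1 p.d₁ p.ε₀ p.βx ^ 2) * c * M₂) ≤ BR)
    (memF : ℕ → ℤ → ℕ → KIdx d ℓ hd hL b₀ b₁) [∀ k P n, Fintype (geo9K (memF k P n)).Site] [∀ k P n, DecidableEq (geo9K (memF k P n)).Site]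
    (ιBF : ∀ k P n, BlkY (memF k P n) → IBondY (memF k P n)) (Rr : ℝ) (Hp : Prop) (sF : ℕ → ℤ → ℕ → ℝ) :
    letI : CStarAlgebra (Matrix (Fin N) (Fin N) ℂ) := {}
    ∃ B₂ c₁ : ℝ, 0 < B₂ ∧ 0 < c₁ ∧ ∀ (m K k : ℕ) (η : ℝ), 1 ≤ k → k ≤ m + K → 0 < η →
      (∀ n, 1 ≤ n → n ≤ k → (((PV d ℓ (memF k (((PV d ℓ m K hd hL).sitesPerDir 0 : ℕ) : ℤ) n).m
          (memF k (((PV d ℓ m K hd hL).sitesPerDir 0 : ℕ) : ℤ) n).K hd hL).sitesPerDir 0 : ℕ) : ℤ) = (((PV d ℓ m K hd hL).sitesPerDir 0 : ℕ) : ℤ)) →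
      (∀ n, 1 ≤ n → n ≤ k → ∀ z : SiteY (memF k (((PV d ℓ m K hd hL).sitesPerDir 0 : ℕ) : ℤ) n),
          levY (memF k (((PV d ℓ m K hd hL).sitesPerDir 0 : ℕ) : ℤ) n) z = n) →
      (∀ n, 1 ≤ n → n ≤ k → (memF k (((PV d ℓ m K hd hL).sitesPerDir 0 : ℕ) : ℤ) n).k ≤ n + es) →
      (∀ n, 1 ≤ n → n ≤ k → ∀ ⦃α₀ : ℝ⦄, 0 < α₀ → α₀ ≤ cL → ∀ U₀ : LSite (d + 1) → Fin (d + 1) → (Matrix (Fin N) (Fin N) ℂ)ˣ,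
          (∀ x κ, U₀ x κ ∈ specialUnitaryUnits (Fin N)) →
          (∀ (x : LSite (d + 1)) (μ : Fin (d + 1)), U₀ (x + (((PV d ℓ m K hd hL).sitesPerDir 0 : ℕ) : ℤ) • e μ) = U₀ x) →
          InAk (ℓ + 1) n η α₀ (fun _ => (Set.univ : Set (LSite (d + 1)))) U₀ →
          Nonempty (KnitCubeInputs (memF k (((PV d ℓ m K hd hL).sitesPerDir 0 : ℕ) : ℤ) n)
            (bgY (memF k (((PV d ℓ m K hd hL).sitesPerDir 0 : ℕ) : ℤ) n) U₀) b (ιBF k (((PV d ℓ m K hd hL).sitesPerDir 0 : ℕ) : ℤ) n) Rr Hp p c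
            (sF k (((PV d ℓ m K hd hL).sitesPerDir 0 : ℕ) : ℤ) n))) →
      (∀ m', m' ≤ k → ∀ ⦃α₀ : ℝ⦄, 0 < α₀ → α₀ ≤ cL → ∀ U₀ : LSite (d + 1) → Fin (d + 1) → (Matrix (Fin N) (Fin N) ℂ)ˣ,
          (∀ x κ, U₀ x κ ∈ specialUnitaryUnits (Fin N)) →
          (∀ (x : LSite (d + 1)) (μ : Fin (d + 1)), U₀ (x + (((PV d ℓ m K hd hL).sitesPerDir 0 : ℕ) : ℤ) • e μ) = U₀ x) →
          InAk (ℓ + 1) m' η α₀ (fun _ => (Set.univ : Set (LSite (d + 1)))) U₀ →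
          B9P3PerAt (𝔸 := Matrix (Fin N) (Fin N) ℂ) (ℓ + 1) B₀ B₀β cB9 β len η m' α₀ (((PV d ℓ m K hd hL).sitesPerDir 0 : ℕ) : ℤ) U₀) →
      Thm2SetupSUAt (PV d ℓ m K hd hL) N k η 0 B₁ B₂ c₁ len (fun _ => True) := by
  letI : CStarAlgebra (Matrix (Fin N) (Fin N) ℂ) := {}
  obtain ⟨B₂, c₁, hB₂pos, hc₁, H⟩ :=
    thm2TorusAt_specialUnitary_ofCubes_tr (len := len) (B₀β := B₀β) (β := β) hN hd2 hB₀ hB₀' hB hB₀'H hB₂' hBG hBR hcB9 hcL hfree hB₁ p hp es hαe hBGe hBG₁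
      hBH hBH₁ hB₂ hBRe memF ιBF Rr Hp sF
  refine ⟨B₂, c₁, hB₂pos, hc₁, fun m K k η hk hkK hη hP hlev hke hcube hb9 => thm2SetupSUAt_of_thm2TorusAt ?_⟩
  exact H k _ η hk hη (pow_dvd_period (PV d ℓ m K hd hL) (j := 0) (by simpa using hkK)) hP hlev hke hcube hb9

end Setup

/-! ## §4 ★★★★★★★ The derived numeric windows discharged: `∃ B₁ B₂ c₁ > 0` -/

section Windows

variable {N : ℕ}

/-- the window `B_G` := the larger of the two (E12) thresholds (and `0`). [cite: Balaban1985RegularSpaces, (1.101) p.93; Balaban1985BackgroundPropagators, Thm 3.1 (3.42) p.397] -/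
def windowBG (d : ℕ) {ι : Type} [Fintype ι] (b : Module.Basis ι ℝ (Matrix (Fin N) (Fin N) ℂ)) (M₂ c : ℝ) (p : KnitCubeParams) : ℝ :=
  max (max ((∑ j, ‖b j‖) * p.A * c * M₂) ((∑ j, ‖b j‖) * p.AD d b M₂ * c * M₂)) 0

/-- the window `B₀′ᴴ` := the larger of the two (E6)∕(E7) thresholds (and `1`). [cite: Balaban1985RegularSpaces, (1.91)–(1.92) p.91, (1.98) p.92; Balaban1985BackgroundPropagators, Thm 3.2 (3.48) p.398] -/
def windowBH (d : ℕ) {ι : Type} [Fintype ι] (b : Module.Basis ι ℝ (Matrix (Fin N) (Fin N) ℂ)) (M₂ c : ℝ) (p : KnitCubeParams) : ℝ :=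
  max (max ((∑ j, ‖b j‖) * (((M₂ * ∑ j, ‖b j‖) * p.A * p.A * p.KC b M₂ * B6.c1 p.d₁ p.ε₀ p.βx ^ 2) * c * M₂))
    ((∑ j, ‖b j‖) * (((M₂ * ∑ j, ‖b j‖) * p.AD d b M₂ * p.A * p.KC b M₂ * B6.c1 p.d₁ p.ε₀ p.βx ^ 2) * c * M₂))) 1

/-- the window `B₂′` := the (E8) threshold (and `0`). [cite: Balaban1985RegularSpaces, (1.98) p.92; Balaban1985BackgroundPropagators, Thm 3.2 (3.48) p.398] -/
def windowB₂ {ι : Type} [Fintype ι] (b : Module.Basis ι ℝ (Matrix (Fin N) (Fin N) ℂ)) (M₂ c : ℝ) (p : KnitCubeParams) : ℝ :=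
  max ((∑ j, ‖b j‖) * (((M₂ * ∑ j, ‖b j‖) * p.A * p.KC b M₂ * B6.c1 p.d₁ p.ε₀ p.βx) * c * M₂)
    + (∑ j, ‖b j‖) * (((M₂ * ∑ j, ‖b j‖) * p.A * p.A * p.KC b M₂ * B6.c1 p.d₁ p.ε₀ p.βx ^ 2) * c * M₂)) 0

/-- the window `B_R` := the (E15) threshold (and `0`). [cite: Balaban1985RegularSpaces, (1.98) p.92 («|Rf|»); Balaban1985BackgroundPropagators, (3.25) p.394] -/
def windowBR {ι : Type} [Fintype ι] (b : Module.Basis ι ℝ (Matrix (Fin N) (Fin N) ℂ)) (M₂ c : ℝ) (p : KnitCubeParams) : ℝ :=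
  max (1 + (∑ j, ‖b j‖) * (((M₂ * ∑ j, ‖b j‖) ^ 2 * p.A * p.KC b M₂ * p.A * B6.c1 p.d₁ p.ε₀ p.βx ^ 2) * c * M₂)) 0

/-- the window `B₀′ := 3·(2(d+1)L²)·B_G·(B_R + 2)` (and `1`) of the endpoint's `hfree`. [cite: Balaban1985RegularSpaces, Prop. 5 p.94, (1.101) p.93, bookkeeping] -/
def windowB₀' (d ℓ : ℕ) {ι : Type} [Fintype ι] (b : Module.Basis ι ℝ (Matrix (Fin N) (Fin N) ℂ)) (M₂ c : ℝ) (p : KnitCubeParams) : ℝ :=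
  max (3 * (2 * ((d + 1 : ℕ) : ℝ) * (((ℓ + 1 : ℕ) : ℝ)) ^ 2) * windowBG d b M₂ c p * (windowBR b M₂ c p + 2)) 1

/-- the window `B₁ := 5(d+1)L·B₀·(1 + 11(d+1)²) + 1` of the endpoint's `hB₁` (print: `B₁ = 5dLB₀` p. 83 up to the tree's explicit margin).
[cite: Balaban1985RegularSpaces, Thm 2 p.83 («there exists B₁»), (1.59) p.86] -/
def windowB₁ (d ℓ : ℕ) (B₀ : ℝ) : ℝ :=
  5 * ((d + 1 : ℕ) : ℝ) * ((ℓ + 1 : ℕ) : ℝ) * B₀ * (1 + 11 * (((d + 1 : ℕ) : ℝ)) ^ 2) + 1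

variable [NeZero N]

/-- ★★★★★★★ **[B8] THM 2 AT THE `SU(N)`-VALUED SETUP-TORUS OBJECTS, THE DERIVED WINDOWS DISCHARGED**: for `1 ≤ N ≤ 25`, `d + 1 ≥ 2`, `L = ℓ + 1`, the (B)-line
constants `B₀ ≥ 2∕(5(d+1)L)`, `c_B9 > 0`, a threshold `c_L > 0`, valid cube scalars `p` with the slack coupling `c_L·L^{2e_s} < α₀′`, a member catalogue `memF`
(with block geometries, sections `ιBF`, units `sF`) — THERE EXIST `B₁, B₂, c₁ > 0` (namely `B₁ = windowB₁`, the pair of §3 at the windows `windowBG … windowB₀'`)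
such that for EVERY `m K k η` (`1 ≤ k ≤ m + K`, `η > 0`): catalogue props → cube packages at every member and `SU(N)`-valued periodic background of the class →
(B)-lines → `Thm2SetupSUAt (PV d ℓ m K hd hL) N k η 0 B₁ B₂ c₁ len (fun _ => True)`.  This is the shape the consumer `prop2Printed_sPrint_of_thm2SetupSUAt` reads
(`∃ B₁ c₁ > 0` uniform over the family; `β₀ = 0`, `B₂`, `len` per member allowed).  HONEST SCOPE: the three arrows' antecedents are displayed and inhabited by
nothing here; no estimate of [B8]∕[4] is proved in files A1–A9; `stub_PV3A` NOT discharged; the Yang–Mills mass gap is NOT proved.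
[cite: Balaban1985RegularSpaces, Thm 2 p.83 («there exists B₁ such that the above theorem holds»), (1.33)–(1.39) pp.82–83, p.77, p.76; Balaban1985BackgroundPropagators, Thm 3.1 (3.42) p.397, Thm 3.2 (3.48) p.398, Thm 3.7 pp.409–410, Thm 3.9 p.413; Balaban1985Averaging, (4) p.18, Prop. 2 p.26] -/
theorem thm2SetupSUAt_ofCubes_exists (hN : N ≤ 25) (hd2 : 2 ≤ d + 1)
    {B₀ B₀β cB9 β cL : ℝ} {len : LSite (d + 1) → ℝ}
    (hB₀ : 0 < B₀) (hB : 2 ≤ 5 * ((d + 1 : ℕ) : ℝ) * ((ℓ + 1 : ℕ) : ℝ) * B₀) (hcB9 : 0 < cB9) (hcL : 0 < cL)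
    {ι : Type} [Fintype ι] [DecidableEq ι] {b : Module.Basis ι ℝ (Matrix (Fin N) (Fin N) ℂ)} {M₂ c : ℝ}
    (p : KnitCubeParams) (hp : p.Valid d ℓ b M₂) (es : ℕ) (hαe : cL * (((ℓ + 1 : ℕ) : ℝ)) ^ (2 * es) < p.α₀')
    (memF : ℕ → ℤ → ℕ → KIdx d ℓ hd hL b₀ b₁) [∀ k P n, Fintype (geo9K (memF k P n)).Site] [∀ k P n, DecidableEq (geo9K (memF k P n)).Site]
    (ιBF : ∀ k P n, BlkY (memF k P n) → IBondY (memF k P n)) (Rr : ℝ) (Hp : Prop) (sF : ℕ → ℤ → ℕ → ℝ) :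
    letI : CStarAlgebra (Matrix (Fin N) (Fin N) ℂ) := {}
    ∃ B₁ B₂ c₁ : ℝ, 0 < B₁ ∧ 0 < B₂ ∧ 0 < c₁ ∧ ∀ (m K k : ℕ) (η : ℝ), 1 ≤ k → k ≤ m + K → 0 < η →
      (∀ n, 1 ≤ n → n ≤ k → (((PV d ℓ (memF k (((PV d ℓ m K hd hL).sitesPerDir 0 : ℕ) : ℤ) n).m
          (memF k (((PV d ℓ m K hd hL).sitesPerDir 0 : ℕ) : ℤ) n).K hd hL).sitesPerDir 0 : ℕ) : ℤ) = (((PV d ℓ m K hd hL).sitesPerDir 0 : ℕ) : ℤ)) →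
      (∀ n, 1 ≤ n → n ≤ k → ∀ z : SiteY (memF k (((PV d ℓ m K hd hL).sitesPerDir 0 : ℕ) : ℤ) n),
          levY (memF k (((PV d ℓ m K hd hL).sitesPerDir 0 : ℕ) : ℤ) n) z = n) →
      (∀ n, 1 ≤ n → n ≤ k → (memF k (((PV d ℓ m K hd hL).sitesPerDir 0 : ℕ) : ℤ) n).k ≤ n + es) →
      (∀ n, 1 ≤ n → n ≤ k → ∀ ⦃α₀ : ℝ⦄, 0 < α₀ → α₀ ≤ cL → ∀ U₀ : LSite (d + 1) → Fin (d + 1) → (Matrix (Fin N) (Fin N) ℂ)ˣ,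
          (∀ x κ, U₀ x κ ∈ specialUnitaryUnits (Fin N)) →
          (∀ (x : LSite (d + 1)) (μ : Fin (d + 1)), U₀ (x + (((PV d ℓ m K hd hL).sitesPerDir 0 : ℕ) : ℤ) • e μ) = U₀ x) →
          InAk (ℓ + 1) n η α₀ (fun _ => (Set.univ : Set (LSite (d + 1)))) U₀ →
          Nonempty (KnitCubeInputs (memF k (((PV d ℓ m K hd hL).sitesPerDir 0 : ℕ) : ℤ) n)
            (bgY (memF k (((PV d ℓ m K hd hL).sitesPerDir 0 : ℕ) : ℤ) n) U₀) b (ιBF k (((PV d ℓ m K hd hL).sitesPerDir 0 : ℕ) : ℤ) n) Rr Hp p c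
            (sF k (((PV d ℓ m K hd hL).sitesPerDir 0 : ℕ) : ℤ) n))) →
      (∀ m', m' ≤ k → ∀ ⦃α₀ : ℝ⦄, 0 < α₀ → α₀ ≤ cL → ∀ U₀ : LSite (d + 1) → Fin (d + 1) → (Matrix (Fin N) (Fin N) ℂ)ˣ,
          (∀ x κ, U₀ x κ ∈ specialUnitaryUnits (Fin N)) →
          (∀ (x : LSite (d + 1)) (μ : Fin (d + 1)), U₀ (x + (((PV d ℓ m K hd hL).sitesPerDir 0 : ℕ) : ℤ) • e μ) = U₀ x) →
          InAk (ℓ + 1) m' η α₀ (fun _ => (Set.univ : Set (LSite (d + 1)))) U₀ →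
          B9P3PerAt (𝔸 := Matrix (Fin N) (Fin N) ℂ) (ℓ + 1) B₀ B₀β cB9 β len η m' α₀ (((PV d ℓ m K hd hL).sitesPerDir 0 : ℕ) : ℤ) U₀) →
      Thm2SetupSUAt (PV d ℓ m K hd hL) N k η 0 B₁ B₂ c₁ len (fun _ => True) := by
  letI : CStarAlgebra (Matrix (Fin N) (Fin N) ℂ) := {}
  -- the six derived windows
  have hBG : 0 ≤ windowBG d b M₂ c p := le_max_right _ _
  have hBH : 0 < windowBH d b M₂ c p := lt_of_lt_of_le one_pos (le_max_right _ _)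
  have hB₂ : 0 ≤ windowB₂ b M₂ c p := le_max_right _ _
  have hBR : 0 ≤ windowBR b M₂ c p := le_max_right _ _
  have hB₀' : 0 < windowB₀' d ℓ b M₂ c p := lt_of_lt_of_le one_pos (le_max_right _ _)
  have hfree : 3 * (2 * ((d + 1 : ℕ) : ℝ) * (((ℓ + 1 : ℕ) : ℝ)) ^ 2) * windowBG d b M₂ c p * (windowBR b M₂ c p + 2) ≤ windowB₀' d ℓ b M₂ c p :=
    le_max_left _ _
  have hB₁ : 5 * ((d + 1 : ℕ) : ℝ) * ((ℓ + 1 : ℕ) : ℝ) * B₀ * (1 + 11 * (((d + 1 : ℕ) : ℝ)) ^ 2) < windowB₁ d ℓ B₀ := lt_add_one _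
  have hB₁pos : 0 < windowB₁ d ℓ B₀ := by unfold windowB₁; positivity
  have hBGe : (∑ j, ‖b j‖) * p.A * c * M₂ ≤ windowBG d b M₂ c p := (le_max_left _ _).trans (le_max_left _ _)
  have hBG₁ : (∑ j, ‖b j‖) * p.AD d b M₂ * c * M₂ ≤ windowBG d b M₂ c p := (le_max_right _ _).trans (le_max_left _ _)
  have hBHe : (∑ j, ‖b j‖) * (((M₂ * ∑ j, ‖b j‖) * p.A * p.A * p.KC b M₂ * B6.c1 p.d₁ p.ε₀ p.βx ^ 2) * c * M₂) ≤ windowBH d b M₂ c p :=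
    (le_max_left _ _).trans (le_max_left _ _)
  have hBH₁ : (∑ j, ‖b j‖) * (((M₂ * ∑ j, ‖b j‖) * p.AD d b M₂ * p.A * p.KC b M₂ * B6.c1 p.d₁ p.ε₀ p.βx ^ 2) * c * M₂) ≤ windowBH d b M₂ c p :=
    (le_max_right _ _).trans (le_max_left _ _)
  have hB₂e : (∑ j, ‖b j‖) * (((M₂ * ∑ j, ‖b j‖) * p.A * p.KC b M₂ * B6.c1 p.d₁ p.ε₀ p.βx) * c * M₂)
      + (∑ j, ‖b j‖) * (((M₂ * ∑ j, ‖b j‖) * p.A * p.A * p.KC b M₂ * B6.c1 p.d₁ p.ε₀ p.βx ^ 2) * c * M₂) ≤ windowB₂ b M₂ c p := le_max_left _ _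
  have hBRe : 1 + (∑ j, ‖b j‖) * (((M₂ * ∑ j, ‖b j‖) ^ 2 * p.A * p.KC b M₂ * p.A * B6.c1 p.d₁ p.ε₀ p.βx ^ 2) * c * M₂) ≤ windowBR b M₂ c p :=
    le_max_left _ _
  obtain ⟨B₂, c₁, hB₂pos, hc₁, H⟩ :=
    thm2SetupSUAt_ofCubes_tr (len := len) (B₀β := B₀β) (β := β) hN hd2 hB₀ hB₀' hB hBH hB₂ hBG hBR hcB9 hcL hfree hB₁ p hp es hαe hBGe hBG₁ hBHe hBH₁ hB₂e
      hBRe memF ιBF Rr Hp sF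
  exact ⟨windowB₁ d ℓ B₀, B₂, c₁, hB₁pos, hB₂pos, hc₁, H⟩

end Windows

end Literature.MathematicalPhysics.QuantumFieldTheory.Balaban1983to89.B8Thm2SetupTorusOfCubes

end
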